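import Summits.ABC.IUTFork.Cor312Statement
import Summits.ABC.IUTFork.Thm311Pilot
import Mathlib.Algebra.BigOperators.Finprod
import HarnessLib

/-!
# [IUTchIII] Corollary 3.12, statement — dictionary with c312-1's nouns (`Thm311Pilot.PilotNouns`)

Record-only file (D-0012) of the abc-iut cell (Cor. 3.12 crew, wave 2, seat abc-iut-c312-7; claim W2-B); TAKES NO
SIDE. Two typings of the nouns of [IUTchIII] Cor. 3.12 (kurims `paper:url-4b091feeb646` p. 173 l. 41 – p. 174
l. 19) exist in the tree: c312-1's `Thm311.PilotNouns` (file G, the author's terms over `LatticeSituation`: an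
abstract hull closure operator, Θ-pilot regions per `(n, m)` with an (Ind3)-enlargement, `Cor312At n m` over
`ℝ` with a finiteness `Prop`) and c312-7's `Cor312.Setting` (`Cor312Statement.lean`: hull-sets of a
`HullFrame`, Kummer images per `m` with `thetaRegion3 = ⋃ₘ`, pilot OBJECTS of L6-t4, `Statement` over
`WithTop ℝ`). This file is the DICTIONARY between them, kernel-checked: `Setting.toPilotNouns` instantiates G's
signature from a `Setting` (hull ← `HullFrame.hullClosure`; regions ← the setting's); the two groups of
indeterminacies coincide (`indGroup_eq`, `rfl`); the possible images, the hulls `^{n,∘}𝒰_{j,v_ℚ}` and the q-images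
coincide (`possibleImages_eq`, `uhol_eq`, `rfl`); under `ThetaFinite` the two `−|log(Θ)|` and `−|log(q)|` agree
(`negLogTheta_eq`, `negLogQ_eq`, by re-indexing G's `(1/l⋇)·Σᶠ_{j ∈ 𝔽_l^⋇}` along the enumeration
`succEquiv : Fin l⋇ ≃ 𝔽_l^⋇` into L6-t4's `processionNormalized` — the same identity as c312-1's Dictionary
`negLogTheta_eq_processionNormalized`, proved here locally so that this file depends on landed files only); G's finiteness clauses `NegLogThetaReal`/`NegLogQReal` are THEOREMS of a setting (`negLogThetaReal`,
`negLogQReal`); hence `cor312At_iff_statement : Cor312At P.n m ↔ Statement` under `ThetaFinite`, and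
`cor312At_of_statement` with no extra hypothesis. Nothing asserted about Cor. 3.12.
[claim: Mochizuki2012, status: disputed]
-/

noncomputable section

namespace Summit.ABC.IUTFork.Cor312

open Thm311 Literature.IUT.LogThetaLattice

variable {T : ThetaIndex}

/-- The enumeration `Fin l⋇ ≃ 𝔽_l^⋇`, `i ↦ i + 1` (`Setting.labelSucc`). [folklore] -/
def succEquiv (T : ThetaIndex) : Fin T.lstar ≃ T.LabelStar where
  toFun i := ⟨i.succ, Fin.succ_ne_zero i⟩
  invFun j := j.1.pred j.2
  left_inv i := by simp
  right_inv j := by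
    apply Subtype.ext
    simp

/-- `succEquiv` enumerates by `labelSucc`. [folklore] -/
theorem succEquiv_val (i : Fin T.lstar) : (succEquiv T i).1 = Setting.labelSucc i := rfl

/-- … and its inverse is undone by `labelSucc`. [folklore] -/
theorem labelSucc_symm (j : T.LabelStar) : Setting.labelSucc ((succEquiv T).symm j) = j.1 :=
  Fin.succ_pred j.1 j.2

/-- Re-indexing a `finsum` over `𝔽_l^⋇` as a `Finset` sum over `Fin l⋇` along `succEquiv`. [folklore] -/
theorem finsum_labelStar_eq_sum (g : T.LabelStar → ℝ) :
    ∑ᶠ j : T.LabelStar, g j = ∑ i : Fin T.lstar, g (succEquiv T i) := by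
  classical
  letI : Fintype T.LabelStar := Fintype.ofEquiv _ (succEquiv T)
  rw [finsum_eq_sum_of_fintype]
  exact (Fintype.sum_equiv (succEquiv T) (fun i => g (succEquiv T i)) g fun _ => rfl).symm

/-- G's normalisation `(1/l⋇)·Σᶠ_{j ∈ 𝔽_l^⋇}` IS L6-t4's `processionNormalized` along `succEquiv` (cf. c312-1's
`PilotNouns.negLogTheta_eq_processionNormalized`). [folklore] -/
theorem processionNormalized_eq_finsum (g : T.LabelStar → ℝ) :
    processionNormalized (fun i : Fin T.lstar => g (succEquiv T i)) = (1 / (T.lstar : ℝ)) * ∑ᶠ j, g j := by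
  rw [finsum_labelStar_eq_sum, processionNormalized, div_eq_mul_inv, mul_comm, one_div]

namespace Setting

variable {S : LatticeSituation T} (P : Setting S.toSituation)

/-- c312-1's `PilotNouns` (file G) INSTANTIATED from a setting: the hull closure operator of the frame (the
same for every line `n`), the Kummer images `thetaRegion m`, their (Ind3)-union `thetaRegion3`, the q-image.
[claim: Mochizuki2012, status: disputed] -/
def toPilotNouns : PilotNouns S where
  hull := fun _ j vQ => (P.frame j vQ).hullClosure
  thetaRegion := fun _ m j vQ => P.thetaRegion m j.1 vQ
  thetaRegion3 := fun _ _ j vQ => P.thetaRegion3 j.1 vQ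
  thetaRegion_subset := fun _ m j vQ => Set.subset_iUnion (fun m' => P.thetaRegion m' j.1 vQ) m
  qRegion := fun _ _ j vQ => P.qRegion j.1 vQ

/-- The two typings of "the indeterminacies (Ind1), (Ind2) acting" are the same subgroup. [folklore] -/
theorem indGroup_eq : S.L.IndGroup = indGroup S.toSituation := rfl

/-- The possible images coincide (component `j ∈ 𝔽_l^⋇`). [folklore] -/
theorem possibleImages_eq (n m : ℤ) (j : T.LabelStar) (vQ : T.VQ) :
    P.toPilotNouns.possibleImages n m j vQ = P.possibleImages j.1 vQ := rfl

/-- The hulls `^{n,∘}𝒰_{j,v_ℚ}` coincide. [folklore] -/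
theorem uhol_eq (n m : ℤ) (j : T.LabelStar) (vQ : T.VQ) :
    P.toPilotNouns.Uhol n m j vQ = P.thetaHull j.1 vQ := rfl

/-- The q-images coincide. [folklore] -/
theorem qRegion_eq (n m : ℤ) (j : T.LabelStar) (vQ : T.VQ) :
    P.toPilotNouns.qRegion n m j vQ = P.qRegion j.1 vQ := rfl

/-- Under `HullDefined` the setting's local term is the real log-volume of the hull. [folklore] -/
theorem thetaLocal_untopD {j : T.Label} {vQ : T.VQ} (h : P.HullDefined j vQ) :
    (P.thetaLocal j vQ).untopD 0 = (S.D P.n).logvol j vQ (P.thetaHull j vQ) := by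
  unfold Setting.thetaLocal
  rw [if_pos h, WithTop.untopD_coe]

/-- `ThetaFinite` gives `HullDefined` at every label in `𝔽_l^⋇`. [folklore] -/
theorem hullDefined_of_thetaFinite (h : P.ThetaFinite) (i : Fin T.lstar) (vQ : T.VQ) :
    P.HullDefined (labelSucc i) vQ := by
  by_contra hb
  exact h.1 i vQ (by unfold Setting.thetaLocal; rw [if_neg hb])

/-- `−|log(Θ)|`: under `ThetaFinite`, G's real number at the setting's column equals the setting's.
[claim: Mochizuki2012, status: disputed] -/
theorem negLogTheta_eq (h : P.ThetaFinite) (m : ℤ) :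
    P.negLogTheta = ((P.toPilotNouns.negLogTheta P.n m : ℝ) : WithTop ℝ) := by
  unfold Setting.negLogTheta PilotNouns.negLogTheta
  rw [if_pos h, ← processionNormalized_eq_finsum]
  congr 1
  congr 1
  funext i
  refine finsum_congr fun vQ => ?_
  rw [P.thetaLocal_untopD (P.hullDefined_of_thetaFinite h i vQ)]
  rfl

/-- `−|log(q)|`: G's real number at the setting's column equals the setting's. [claim: Mochizuki2012, status: disputed] -/
theorem negLogQ_eq (m : ℤ) : P.negLogQ = P.toPilotNouns.negLogQ P.n m := by
  unfold Setting.negLogQ PilotNouns.negLogQ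
  rw [← processionNormalized_eq_finsum]
  rfl

/-- Finiteness over the pairs `(j, v_ℚ) ∈ 𝔽_l^⋇ × 𝕍_ℚ` from finiteness of each label's support (`𝔽_l^⋇` is
finite). [folklore] -/
theorem finite_pairs_of_labelwise {f : T.LabelStar → T.VQ → ℝ}
    (h : ∀ j, (Function.support (f j)).Finite) : {p : T.LabelStar × T.VQ | f p.1 p.2 ≠ 0}.Finite := by
  have hsub : {p : T.LabelStar × T.VQ | f p.1 p.2 ≠ 0} ⊆
      ⋃ j, (fun vQ => (j, vQ)) '' Function.support (f j) := by
    rintro ⟨j, vQ⟩ hp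
    exact Set.mem_iUnion.2 ⟨j, vQ, hp, rfl⟩
  exact (Set.finite_iUnion fun j => (h j).image _).subset hsub

/-- G's q-side clause `NegLogQReal` HOLDS for the nouns of a setting: the q-images are hull-sets, hence
admissible (`qRegion_mem`, `hul_adm`), with finitely many nonzero log-volumes per label (`qSupport_finite`).
PROVED. [folklore] -/
theorem negLogQReal (m : ℤ) : P.toPilotNouns.NegLogQReal P.n m := by
  refine ⟨fun j vQ => P.hul_adm j.1 vQ _ (P.qRegion_mem j.1 vQ), ?_⟩
  exact finite_pairs_of_labelwise (f := fun j vQ => (S.D P.n).logvol j.1 vQ (P.qRegion j.1 vQ))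
    fun j => P.qSupport_finite j.1

/-- G's Θ-side clause `NegLogThetaReal` follows from the setting's `ThetaFinite`: every `^{n,∘}𝒰_{j,v_ℚ}` is then a
hull-set (`thetaHull_adm`) and each label has finitely many nonzero hull-volumes. PROVED. [folklore] -/
theorem negLogThetaReal (h : P.ThetaFinite) (m : ℤ) : P.toPilotNouns.NegLogThetaReal P.n m := by
  have hdef : ∀ (j : T.LabelStar) (vQ : T.VQ), P.HullDefined j.1 vQ := fun j vQ => by
    have := P.hullDefined_of_thetaFinite h ((succEquiv T).symm j) vQ
    rwa [labelSucc_symm] at this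
  refine ⟨fun j vQ => P.thetaHull_adm (hdef j vQ), ?_⟩
  refine finite_pairs_of_labelwise (f := fun j vQ => (S.D P.n).logvol j.1 vQ (P.thetaHull j.1 vQ)) ?_
  intro j
  have hf := h.2 ((succEquiv T).symm j)
  have hj : labelSucc ((succEquiv T).symm j) = j.1 := labelSucc_symm j
  refine hf.subset fun vQ hvQ => ?_
  simp only [Function.mem_support, ne_eq] at hvQ ⊢
  rwa [P.thetaLocal_untopD (P.hullDefined_of_thetaFinite h _ vQ), hj]

/-- G's `Cor312At` at the setting's column, together with the setting's `ThetaFinite`, gives the verbatim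
`Statement`. [folklore] -/
theorem statement_of_cor312At (h : P.ThetaFinite) {m : ℤ} (hc : P.toPilotNouns.Cor312At P.n m) :
    P.Statement := by
  refine ⟨by rw [P.negLogTheta_eq h m]; exact WithTop.coe_ne_top, ?_⟩
  rw [P.negLogTheta_eq h m, P.negLogQ_eq m]
  exact WithTop.coe_le_coe.2 hc.2.2

/-- The verbatim `Statement` forces `ThetaFinite` (else `−|log(Θ)| = ⊤`). [folklore] -/
theorem thetaFinite_of_statement (hs : P.Statement) : P.ThetaFinite := by
  by_contra h
  exact hs.1 (by unfold Setting.negLogTheta; rw [if_neg h])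

/-- Conversely the verbatim `Statement` gives G's `Cor312At` at the setting's column — with NO extra
hypothesis: both of G's finiteness clauses are theorems of the setting (`negLogThetaReal`, `negLogQReal`).
[folklore] -/
theorem cor312At_of_statement (m : ℤ) (hs : P.Statement) : P.toPilotNouns.Cor312At P.n m := by
  have hfin := P.thetaFinite_of_statement hs
  refine ⟨P.negLogThetaReal hfin m, P.negLogQReal m, ?_⟩
  have h2 := hs.2
  rw [P.negLogTheta_eq hfin m, P.negLogQ_eq m] at h2
  exact WithTop.coe_le_coe.1 h2

/-- DICTIONARY, final form: under the setting's `ThetaFinite` ("`−|log(Θ)| ∈ ℝ`"), c312-1's `Cor312At` at the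
setting's column (any `m`) and c312-7's verbatim `Statement` are EQUIVALENT. [folklore] -/
theorem cor312At_iff_statement (h : P.ThetaFinite) (m : ℤ) :
    P.toPilotNouns.Cor312At P.n m ↔ P.Statement :=
  ⟨P.statement_of_cor312At h, P.cor312At_of_statement m⟩

end Setting

end Summit.ABC.IUTFork.Cor312

end
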